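import Summits.NavierStokesRegularity.NavierStokesRegularity.Theorems.ExtremiserTransienceRegularisedNearPlateauStabilitySparseBangBangTestFieldPotential
import Summits.NavierStokesRegularity.NavierStokesRegularity.Theorems.ExtremiserTransienceRegularisedNearPlateauStabilitySparseBangBangTestFieldLocal
import Summits.NavierStokesRegularity.NavierStokesRegularity.Theorems.ExtremiserTransienceRegularisedNearPlateauStabilitySparseBangBangCount
import Mathlib.Analysis.Calculus.LocalExtr.Basic
import HarnessLib

/-!
# Route `ExtremiserTransience`, crux `RegularisedNearPlateauStability` (stmt-NavierStokesRegularity-28317),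
# LINE g8-α «sparse bang-bang»: THE TOP TEST FIELD `η = −ζ·ψ̂` OF A SPARSE A-REGULAR FIELD (step P4)

`--supports stmt-NavierStokesRegularity-28317` (helper). Author: prover seat `ns-net-p2` (g2).

`exists_topTestField`: for a derivative budget `A` and a sparseness window `n₀·M² ≤ W·λ ≤ N₀·M²` there is a δ-FREE
constant `Ψ₀(A, N₀)` and, for every `0 < δ ≤ 1/2`, constants `Λ(A,N₀,n₀,δ)`, `σ₀(A,N₀,δ)` such that every admissible
`A`-regular field in the window carries a test potential `η ∈ C_c^∞` with
* `η = 0` off the near-top set `{‖v‖ ≥ (1−3δ/4)M}` and `‖η‖ ≤ Ψ₀·M·λ`;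
* SHRINKING ADMISSIBILITY of the direction `curl η`: `‖v + σ·curl η‖ ≤ (1−σ)M` for `|σ| ≤ σ₀`;
* sizes `‖D(curl η)‖ ≤ Λ·M/λ`, `Z(curl η) ≤ Λ²·Z`, `W(curl η) ≤ Λ²·W`.
Construction: `η = −ζ·ψ̂` with the level cut-off `ζ` of `‖v‖²/M²` between the levels `(1−3δ/4)²` and `(1−δ/2)²`
(`…BangBangCoreCutoff`) and the patched radial potential `ψ̂` (`exists_patchedPotential`, `curl ψ̂ = v` on the half-top
set).  Then `curl η = −(ζv + curl∘(Dζ⊗ψ̂))`; on the plateau `{‖v‖ ≥ (1−δ/2)M}` this is `−v` exactly, elsewhere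
`‖v‖ < (1−δ/2)M` absorbs the perturbation (`norm_shrink_le`); the sizes come from the Leibniz budgets of `ζ` and `ψ̂`
and the volume `≤ m₀ρ₀³|B₁|λ³` of the cluster cover against `Z = λ·(Wλ) ≥ n₀M²λ`, `W ≥ n₀M²/λ`.
HONEST FRAMING: a construction for one class of vector fields; nothing about Navier–Stokes is proved; no summit is proved
by a line. [folklore]
-/

noncomputable section

open Set Filter Topology MeasureTheory Metric
open scoped InnerProductSpace RealInnerProductSpace ENNReal ContDiff
open Literature.Analysis.FluidPDE
open Summit.NavierStokesRegularity.NavierStokesRegularity.Theorems.DepletionLadder.KStar.HalfSpace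

namespace Summit.NavierStokesRegularity.NavierStokesRegularity.Theorems

-- the problem directory repeats the summit name (`NavierStokesRegularity/NavierStokesRegularity`)
set_option linter.dupNamespace false

namespace DepletionLadder.KStar.BangBang

/-! ## Three assembly lemmas (derivative budget of `ζ·ψ̂`, the shrinking bound at a point, the three sizes) -/

/-- Derivative budget of `θ = ζ·ψ` up to order three: `θ` vanishes near every point of an open set `U`, and on the
complement `T` of interest the factors obey `‖Dⁱζ‖ ≤ C_z Lⁱ`, `‖Dⁱψ‖ ≤ Q Lⁱ`; then `‖Dⁿθ‖ ≤ 8·C_z·Q·Lⁿ` everywhere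
(`n ≤ 3`). [folklore] -/
theorem norm_iteratedFDeriv_smul_le_of_cover {ζ : E3 → ℝ} {ψ : E3 → E3} (hζ : ContDiff ℝ ∞ ζ) (hψ : ContDiff ℝ ∞ ψ)
    {U T : Set E3} (hUT : ∀ x, x ∈ U ∨ x ∈ T) (hU : ∀ x ∈ U, (fun y => ζ y • ψ y) =ᶠ[𝓝 x] fun _ => (0 : E3))
    {Cz Q L : ℝ} (hCz : 0 ≤ Cz) (hQ : 0 ≤ Q) (hL : 0 ≤ L) (hζD : ∀ i, i ≤ 3 → ∀ x, ‖iteratedFDeriv ℝ i ζ x‖ ≤ Cz * L ^ i)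
    (hψD : ∀ x ∈ T, ∀ i, i ≤ 3 → ‖iteratedFDeriv ℝ i ψ x‖ ≤ Q * L ^ i) {n : ℕ} (hn : n ≤ 3) (x : E3) :
    ‖iteratedFDeriv ℝ n (fun y => ζ y • ψ y) x‖ ≤ 8 * Cz * Q * L ^ n := by
  rcases hUT x with hx | hx
  · rw [((hU x hx).iteratedFDeriv ℝ n).eq_of_nhds, iteratedFDeriv_fun_zero]
    simp only [Pi.zero_apply, norm_zero]
    positivity
  · have h := norm_iteratedFDeriv_smul_le_pow hζ hψ x (n := n) (fun i hi => hζD i (hi.trans hn) x)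
      (fun i hi => hψD x hx i (hi.trans hn))
    refine h.trans ?_
    have h2n : (2 : ℝ) ^ n ≤ 8 := by
      calc (2 : ℝ) ^ n ≤ 2 ^ 3 := pow_le_pow_right₀ (by norm_num) hn
        _ = 8 := by norm_num
    have hprod : 0 ≤ Cz * Q * L ^ n := by positivity
    nlinarith

/-- **The shrinking bound at one point**, from the pointwise data of the construction. [folklore] -/
theorem shrink_at {vx ψx cψx R : E3} {zx M δ σ Λ' Cz L Ψ₀ lam : ℝ} {Dζ : E3 →L[ℝ] ℝ}
    (hM : ‖vx‖ ≤ M) (hMpos : 0 < M) (hz0 : 0 ≤ zx) (hz1 : zx ≤ 1) (hδ : 0 < δ) (hδ2 : δ ≤ 1 / 2)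
    (hCz : 0 ≤ Cz) (hΨ₀ : 0 ≤ Ψ₀) (hlamL : lam * L = 1) (hΛ' : Λ' = ‖curlCLM‖ * Cz * Ψ₀)
    (hσ : |σ| ≤ δ / (2 * (2 + Λ'))) (hR : R = curlCLM (Dζ.smulRight ψx)) (hDζ : ‖Dζ‖ ≤ Cz * L)
    (hlow : ‖vx‖ ≤ (1 - 3 * δ / 4) * M → zx = 0 ∧ Dζ = 0)
    (htop : (1 - 3 * δ / 4) * M < ‖vx‖ → cψx = vx ∧ ‖ψx‖ ≤ Ψ₀ * M * lam)
    (hplat : (1 - δ / 2) * M ≤ ‖vx‖ → zx = 1 ∧ Dζ = 0) :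
    ‖vx + σ • (-(zx • cψx + R))‖ ≤ (1 - σ) * M := by
  have hΛ'0 : 0 ≤ Λ' := by rw [hΛ']; positivity
  have hσ₀le : δ / (2 * (2 + Λ')) ≤ δ / 4 := div_le_div_of_nonneg_left hδ.le (by norm_num) (by linarith)
  by_cases hx : (1 - 3 * δ / 4) * M < ‖vx‖
  · obtain ⟨hcψ, hψ0⟩ := htop hx
    have hRb : ‖R‖ ≤ Λ' * M := by
      rw [hR]
      refine (norm_curlCLM_smulRight_le _ _).trans ?_
      calc ‖curlCLM‖ * ‖Dζ‖ * ‖ψx‖ ≤ ‖curlCLM‖ * (Cz * L) * (Ψ₀ * M * lam) := by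
            have hk0 : 0 ≤ ‖curlCLM‖ := norm_nonneg curlCLM
            have hL0 : 0 ≤ Cz * L := (norm_nonneg _).trans hDζ
            exact mul_le_mul (mul_le_mul_of_nonneg_left hDζ hk0) hψ0 (norm_nonneg _) (mul_nonneg hk0 hL0)
        _ = Λ' * M * (lam * L) := by rw [hΛ']; ring
        _ = Λ' * M := by rw [hlamL, mul_one]
    rw [hcψ]
    refine norm_shrink_le hM hz0 hz1 hδ (by linarith) hΛ'0 hRb hσ ?_
    by_cases hx2 : (1 - δ / 2) * M ≤ ‖vx‖
    · right
      obtain ⟨hz, hD⟩ := hplat hx2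
      refine ⟨hz, ?_⟩
      rw [hR, hD]; simp
    · left; exact le_of_lt (not_le.1 hx2)
  · have hx' : ‖vx‖ ≤ (1 - 3 * δ / 4) * M := not_lt.1 hx
    obtain ⟨hz, hD⟩ := hlow hx'
    have h0 : zx • cψx + R = 0 := by rw [hz, hR, hD, zero_smul, zero_add]; simp
    rw [h0, neg_zero, smul_zero, add_zero]
    have hσ' : σ ≤ δ / 4 := (le_abs_self σ).trans (hσ.trans hσ₀le)
    nlinarith

/-- **The three sizes** of `curl η` from the support `K` and the derivative budget of `η`. [folklore] -/
theorem curl_sizes {η : E3 → E3} (hη : ContDiff ℝ ∞ η) {K : Set E3} (hKc : IsCompact K) (hηK : ∀ x, x ∉ K → η x = 0)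
    {Cη M lam L Vtot n₀ Z W Λ : ℝ} (hMpos : 0 < M) (hlam : 0 < lam) (hL : 0 ≤ L) (hlamL : lam * L = 1)
    (hn₀ : 0 < n₀) (hKvol : (volume K).toReal ≤ Vtot * lam ^ 3)
    (hD2 : ∀ x, ‖iteratedFDeriv ℝ 2 η x‖ ≤ Cη * M * lam * L ^ 2) (hD3 : ∀ x, ‖iteratedFDeriv ℝ 3 η x‖ ≤ Cη * M * lam * L ^ 3)
    (hZlow : n₀ * M ^ 2 * lam ≤ Z) (hWlow : n₀ * M ^ 2 * L ≤ W) (hΛ1 : ‖curlCLM‖ * Cη ≤ Λ)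
    (hΛ2 : 3 * ‖curlCLM‖ ^ 4 * Cη ^ 2 * Vtot / n₀ ≤ Λ ^ 2) :
    (∀ x, ‖fderiv ℝ (curl η) x‖ ≤ Λ * M * L) ∧ Zen (curl η) ≤ Λ ^ 2 * Z ∧ Wpa (curl η) ≤ Λ ^ 2 * W := by
  obtain ⟨hD, hZ, hW⟩ := curl_bounds_of_support hη hKc.isClosed hKc.measure_lt_top hηK hD2 hD3
  have hlamL2 : lam * L ^ 2 = L := by
    calc lam * L ^ 2 = (lam * L) * L := by ring
      _ = L := by rw [hlamL, one_mul]
  have hVtot0 : 0 ≤ Vtot * lam ^ 3 := ENNReal.toReal_nonneg.trans hKvol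
  refine ⟨fun x => ?_, ?_, ?_⟩
  · calc ‖fderiv ℝ (curl η) x‖ ≤ ‖curlCLM‖ * (Cη * M * lam * L ^ 2) := hD x
      _ = ‖curlCLM‖ * Cη * M * (lam * L ^ 2) := by ring
      _ = ‖curlCLM‖ * Cη * M * L := by rw [hlamL2]
      _ ≤ Λ * M * L := mul_le_mul_of_nonneg_right (mul_le_mul_of_nonneg_right hΛ1 hMpos.le) hL
  · calc Zen (curl η) ≤ (‖curlCLM‖ ^ 2 * (Cη * M * lam * L ^ 2)) ^ 2 * (volume K).toReal := hZ
      _ ≤ (‖curlCLM‖ ^ 2 * (Cη * M * lam * L ^ 2)) ^ 2 * (Vtot * lam ^ 3) :=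
          mul_le_mul_of_nonneg_left hKvol (sq_nonneg _)
      _ = ‖curlCLM‖ ^ 4 * Cη ^ 2 * Vtot * M ^ 2 * lam * (lam * L) ^ 4 := by ring
      _ = (3 * ‖curlCLM‖ ^ 4 * Cη ^ 2 * Vtot / n₀) * (n₀ * M ^ 2 * lam) / 3 := by
          rw [hlamL]; field_simp
      _ ≤ Λ ^ 2 * Z / 3 := by
          have := mul_le_mul hΛ2 hZlow (by positivity) (sq_nonneg _)
          linarith
      _ ≤ Λ ^ 2 * Z := by
          have : 0 ≤ Λ ^ 2 * Z := mul_nonneg (sq_nonneg _) (le_trans (by positivity) hZlow)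
          linarith
  · calc Wpa (curl η) ≤ 3 * (‖curlCLM‖ ^ 2 * (Cη * M * lam * L ^ 3)) ^ 2 * (volume K).toReal := hW
      _ ≤ 3 * (‖curlCLM‖ ^ 2 * (Cη * M * lam * L ^ 3)) ^ 2 * (Vtot * lam ^ 3) :=
          mul_le_mul_of_nonneg_left hKvol (by positivity)
      _ = 3 * ‖curlCLM‖ ^ 4 * Cη ^ 2 * Vtot * M ^ 2 * L * (lam * L) ^ 5 := by ring
      _ = (3 * ‖curlCLM‖ ^ 4 * Cη ^ 2 * Vtot / n₀) * (n₀ * M ^ 2 * L) := by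
          rw [hlamL]; field_simp
      _ ≤ Λ ^ 2 * W := mul_le_mul hΛ2 hWlow (by positivity) (sq_nonneg _)

/-! ## The test field for one field, from the data; then the constants -/

/-- The level cut-off between the levels `(1−3δ/4)M` and `(1−δ/2)M`: smooth, `[0,1]`-valued, derivative budget
`C_z Lⁱ` (`i ≤ 3`), `= 0` with `Dζ = 0` below the lower level, `= 1` with `Dζ = 0` above the upper level. [folklore] -/
theorem levelCutoff_package {v : E3 → E3} {M S Cz δ a τ L : ℝ} (hv : ContDiff ℝ ∞ v) (hMpos : 0 < M) (hL0 : 0 ≤ L)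
    (hδ2 : δ ≤ 1 / 2) (hτ : 0 < τ) (ha : a = (1 - 3 * δ / 4) ^ 2) (haτ : a + τ = (1 - δ / 2) ^ 2)
    (hK : ∀ i, i ≤ 3 → ∀ z, ‖iteratedFDeriv ℝ i v z‖ ≤ S * M * L ^ i)
    (hCz : Cz = 48 * 36 * 256 ^ 3 * (2 * max 1 (S ^ 2 / τ)) ^ 3) :
    ContDiff ℝ ∞ (fun y => Real.smoothTransition ((‖v y‖ ^ 2 / M ^ 2 - a) / τ)) ∧
    (∀ y, 0 ≤ Real.smoothTransition ((‖v y‖ ^ 2 / M ^ 2 - a) / τ) ∧ Real.smoothTransition ((‖v y‖ ^ 2 / M ^ 2 - a) / τ) ≤ 1) ∧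
    (∀ i, i ≤ 3 → ∀ x, ‖iteratedFDeriv ℝ i (fun y => Real.smoothTransition ((‖v y‖ ^ 2 / M ^ 2 - a) / τ)) x‖ ≤ Cz * L ^ i) ∧
    (∀ y, ‖v y‖ ≤ (1 - 3 * δ / 4) * M → Real.smoothTransition ((‖v y‖ ^ 2 / M ^ 2 - a) / τ) = 0 ∧
      fderiv ℝ (fun y => Real.smoothTransition ((‖v y‖ ^ 2 / M ^ 2 - a) / τ)) y = 0) ∧
    (∀ y, (1 - δ / 2) * M ≤ ‖v y‖ → Real.smoothTransition ((‖v y‖ ^ 2 / M ^ 2 - a) / τ) = 1 ∧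
      fderiv ℝ (fun y => Real.smoothTransition ((‖v y‖ ^ 2 / M ^ 2 - a) / τ)) y = 0) := by
  set ζ : E3 → ℝ := fun y => Real.smoothTransition ((‖v y‖ ^ 2 / M ^ 2 - a) / τ) with hζdef
  have hζ01 : ∀ y, 0 ≤ ζ y ∧ ζ y ≤ 1 := fun y => levelCutoff_mem_Icc v M a τ y
  have hlev0 : ∀ y, ‖v y‖ ≤ (1 - 3 * δ / 4) * M → ζ y = 0 := by
    intro y hy
    refine levelCutoff_eq_zero hτ hMpos ?_
    calc ‖v y‖ ^ 2 ≤ ((1 - 3 * δ / 4) * M) ^ 2 := pow_le_pow_left₀ (norm_nonneg _) hy 2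
      _ = a * M ^ 2 := by rw [ha]; ring
  have hlev1 : ∀ y, (1 - δ / 2) * M ≤ ‖v y‖ → ζ y = 1 := by
    intro y hy
    refine levelCutoff_eq_one hτ hMpos ?_
    have h0y : 0 ≤ (1 - δ / 2) * M := mul_nonneg (by linarith) hMpos.le
    calc (a + τ) * M ^ 2 = ((1 - δ / 2) * M) ^ 2 := by rw [haτ]; ring
      _ ≤ ‖v y‖ ^ 2 := pow_le_pow_left₀ h0y hy 2
  refine ⟨contDiff_levelCutoff hv M a τ, hζ01, fun i hi x => ?_, fun y hy => ⟨hlev0 y hy, ?_⟩, fun y hy => ⟨hlev1 y hy, ?_⟩⟩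
  · rw [hCz]; exact norm_iteratedFDeriv_levelCutoff_le_three (a := a) hv hτ hMpos hL0 (fun j hj => hK j hj x) hi
  · exact IsLocalMin.fderiv_eq_zero (Filter.Eventually.of_forall fun z => by rw [hlev0 y hy]; exact (hζ01 z).1)
  · exact IsLocalMax.fderiv_eq_zero (Filter.Eventually.of_forall fun z => by rw [hlev1 y hy]; exact (hζ01 z).2)

/-- The test field `η = −ζ·ψ̂` for ONE field, given the patched potential `ψ̂`, the cover set `K` and the constants.
[folklore] -/
theorem exists_eta_of_data {v ψ : E3 → E3} {K : Set E3} {M S Cz Ψ₀ δ a τ L Λ Vtot n₀ : ℝ}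
    (hv : ContDiff ℝ ∞ v) (hM : ∀ x, ‖v x‖ ≤ M) (hMpos : 0 < M) (hlampos : 0 < lam v) (hL0 : 0 ≤ L)
    (hlamL : lam v * L = 1) (hZeq : Zen v = lam v ^ 2 * Wpa v) (hn₀ : 0 < n₀) (hlow : n₀ * M ^ 2 ≤ Wpa v * lam v)
    (hδ : 0 < δ) (hδ2 : δ ≤ 1 / 2) (hτ : 0 < τ) (ha : a = (1 - 3 * δ / 4) ^ 2) (haτ : a + τ = (1 - δ / 2) ^ 2)
    (hK : ∀ i, i ≤ 3 → ∀ z, ‖iteratedFDeriv ℝ i v z‖ ≤ S * M * L ^ i)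
    (hCz : Cz = 48 * 36 * 256 ^ 3 * (2 * max 1 (S ^ 2 / τ)) ^ 3) (hΨ₀ : 0 ≤ Ψ₀)
    (hψ : ContDiff ℝ ∞ ψ) (hKc : IsCompact K) (hKvol : (volume K).toReal ≤ Vtot * lam v ^ 3)
    (hTK : {x | M / 2 ≤ ‖v x‖} ⊆ K)
    (hψT : ∀ x, M / 2 ≤ ‖v x‖ → curl ψ x = v x ∧ ∀ i, i ≤ 3 → ‖iteratedFDeriv ℝ i ψ x‖ ≤ Ψ₀ * (M * lam v) * L ^ i)
    (hΛge1 : ‖curlCLM‖ * (8 * Cz * Ψ₀) ≤ Λ) (hΛge2 : 3 * ‖curlCLM‖ ^ 4 * (8 * Cz * Ψ₀) ^ 2 * Vtot / n₀ ≤ Λ ^ 2) :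
    ∃ η : E3 → E3, ContDiff ℝ ∞ η ∧ HasCompactSupport η ∧
      (∀ x, η x ≠ 0 → (1 - 3 * δ / 4) * M ≤ ‖v x‖) ∧ (∀ x, ‖η x‖ ≤ (Ψ₀ + 1) * M * lam v) ∧
      (∀ σ : ℝ, |σ| ≤ δ / (2 * (2 + ‖curlCLM‖ * Cz * (Ψ₀ + 1))) → ∀ x, ‖v x + σ • curl η x‖ ≤ (1 - σ) * M) ∧
      (∀ x, ‖fderiv ℝ (curl η) x‖ ≤ Λ * M * L) ∧
      Zen (curl η) ≤ Λ ^ 2 * Zen v ∧ Wpa (curl η) ≤ Λ ^ 2 * Wpa v := by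
  have hmax0 : 0 ≤ 2 * max 1 (S ^ 2 / τ) := by linarith [le_max_left (1 : ℝ) (S ^ 2 / τ)]
  have hCz0 : 0 ≤ Cz := by rw [hCz]; positivity
  -- the cut-off and its levels
  set ζ : E3 → ℝ := fun y => Real.smoothTransition ((‖v y‖ ^ 2 / M ^ 2 - a) / τ) with hζdef
  obtain ⟨hζ, hζ01, hζD, hlow0, hplat1⟩ := levelCutoff_package hv hMpos hL0 hδ2 hτ ha haτ hK hCz
  have hlev0 : ∀ y, ‖v y‖ ≤ (1 - 3 * δ / 4) * M → ζ y = 0 := fun y hy => (hlow0 y hy).1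
  have hhalf : M / 2 ≤ (1 - 3 * δ / 4) * M := by
    have : (1 : ℝ) / 2 ≤ 1 - 3 * δ / 4 := by linarith
    have := mul_le_mul_of_nonneg_right this hMpos.le
    linarith
  have hT_of_ne : ∀ y, ζ y ≠ 0 → (1 - 3 * δ / 4) * M < ‖v y‖ := fun y hy => by
    by_contra h; exact hy (hlev0 y (not_lt.1 h))
  -- the test potential `η = -(ζ • ψ)`
  set θ : E3 → E3 := fun y => ζ y • ψ y with hθdef
  have hθ : ContDiff ℝ ∞ θ := hζ.smul hψ
  set η : E3 → E3 := -θ with hηdef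
  have hη : ContDiff ℝ ∞ η := hθ.neg
  have hηx : ∀ x, η x = -(ζ x • ψ x) := fun x => rfl
  -- derivative budget of `η`
  have hUT : ∀ x, x ∈ {y : E3 | ‖v y‖ < (1 - 3 * δ / 4) * M} ∨ x ∈ {y : E3 | M / 2 ≤ ‖v y‖} := fun x => by
    by_cases hx : ‖v x‖ < (1 - 3 * δ / 4) * M
    · exact Or.inl hx
    · exact Or.inr (hhalf.trans (not_lt.1 hx))
  have hU : ∀ x ∈ {y : E3 | ‖v y‖ < (1 - 3 * δ / 4) * M}, θ =ᶠ[𝓝 x] fun _ => (0 : E3) := by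
    intro x hx
    filter_upwards [(isOpen_lt (continuous_norm.comp hv.continuous) continuous_const).mem_nhds hx] with y hy
    simp only [hθdef, hlev0 y (le_of_lt hy), zero_smul]
  have hDη : ∀ n, n ≤ 3 → ∀ x, ‖iteratedFDeriv ℝ n η x‖ ≤ (8 * Cz * Ψ₀) * M * lam v * L ^ n := by
    intro n hn x
    rw [hηdef, iteratedFDeriv_neg_apply, norm_neg]
    have h := norm_iteratedFDeriv_smul_le_of_cover hζ hψ hUT hU hCz0 (by positivity) hL0 hζD
      (fun x hx i hi => (hψT x hx).2 i hi) hn x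
    calc ‖iteratedFDeriv ℝ n (fun y => ζ y • ψ y) x‖ ≤ 8 * Cz * (Ψ₀ * (M * lam v)) * L ^ n := h
      _ = (8 * Cz * Ψ₀) * M * lam v * L ^ n := by ring
  -- `η = 0` off `K`; the potential on the near-top set
  have hηK : ∀ x, x ∉ K → η x = 0 := by
    intro x hx
    have hζx : ζ x = 0 := by
      by_contra h
      exact hx (hTK (hhalf.trans (hT_of_ne x h).le))
    rw [hηx, hζx, zero_smul, neg_zero]
  have hψ0 : ∀ x, (1 - 3 * δ / 4) * M < ‖v x‖ → curl ψ x = v x ∧ ‖ψ x‖ ≤ (Ψ₀ + 1) * M * lam v := by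
    intro x hx
    obtain ⟨hcurl, hDψ⟩ := hψT x (hhalf.trans hx.le)
    refine ⟨hcurl, ?_⟩
    have h0 := hDψ 0 (by norm_num)
    rw [norm_iteratedFDeriv_zero, pow_zero, mul_one] at h0
    have hMl : 0 ≤ M * lam v := by positivity
    have e : (Ψ₀ + 1) * M * lam v = Ψ₀ * (M * lam v) + M * lam v := by ring
    rw [e]; linarith
  refine ⟨η, hη, HasCompactSupport.intro hKc hηK, fun x hx => ?_, fun x => ?_, fun σ hσ x => ?_, ?_⟩
  · have : ζ x ≠ 0 := by
      intro h; rw [hηx, h, zero_smul, neg_zero] at hx; exact hx rfl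
    exact (hT_of_ne x this).le
  · by_cases hζx : ζ x = 0
    · rw [hηx, hζx, zero_smul, neg_zero, norm_zero]; positivity
    · rw [hηx, norm_neg, norm_smul, Real.norm_eq_abs, abs_of_nonneg (hζ01 x).1]
      calc ζ x * ‖ψ x‖ ≤ 1 * ((Ψ₀ + 1) * M * lam v) :=
            mul_le_mul (hζ01 x).2 (hψ0 x (hT_of_ne x hζx)).2 (norm_nonneg _) zero_le_one
        _ = (Ψ₀ + 1) * M * lam v := one_mul _
  · have hζd : DifferentiableAt ℝ ζ x := (hζ.differentiable (by simp)) x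
    have hψd : DifferentiableAt ℝ ψ x := (hψ.differentiable (by simp)) x
    have hcurlη : curl η x = -(ζ x • curl ψ x + curlCLM ((fderiv ℝ ζ x).smulRight (ψ x))) := by
      rw [← curl_smul_eq hζd hψd, curl_eq_curlCLM, curl_eq_curlCLM, hηdef, fderiv_neg, map_neg]
    have hDζ : ‖fderiv ℝ ζ x‖ ≤ Cz * L := by
      have h := hζD 1 (by norm_num) x
      rwa [pow_one, ← norm_iteratedFDeriv_fderiv, norm_iteratedFDeriv_zero] at h
    rw [hcurlη]
    exact shrink_at (hM x) hMpos (hζ01 x).1 (hζ01 x).2 hδ hδ2 hCz0 (by linarith) hlamL rfl hσ rfl hDζ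
      (hlow0 x) (hψ0 x) (hplat1 x)
  · have hZlow : n₀ * M ^ 2 * lam v ≤ Zen v := by
      rw [hZeq]
      calc n₀ * M ^ 2 * lam v ≤ (Wpa v * lam v) * lam v := mul_le_mul_of_nonneg_right hlow hlampos.le
        _ = lam v ^ 2 * Wpa v := by ring
    have hWlow : n₀ * M ^ 2 * L ≤ Wpa v := by
      calc n₀ * M ^ 2 * L ≤ Wpa v * lam v * L := mul_le_mul_of_nonneg_right hlow hL0
        _ = Wpa v * (lam v * L) := by ring
        _ = Wpa v := by rw [hlamL, mul_one]
    exact curl_sizes hη hKc hηK hMpos hlampos hL0 hlamL hn₀ hKvol (hDη 2 (by norm_num)) (hDη 3 le_rfl)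
      hZlow hWlow hΛge1 hΛge2

/-- The test field for ONE field from the constants (count bound `m₀`, budget `S`, `Ψ₀ = ‖cross‖·S·(ρ₀+3)`). [folklore] -/
theorem exists_eta_of_field {A : ℕ → ℝ} {v : E3 → E3} {M B N₀ n₀ S Cz δ τ Λ Vtot : ℝ} {m₀ : ℕ}
    (hAS : ∀ j, j ≤ 3 → A j ≤ S) (hS0 : 0 ≤ S)
    (hm₀ : ∀ (v : E3 → E3) (M B : ℝ), IsAdm v M B → (∀ x, ‖iteratedFDeriv ℝ 1 v x‖ ≤ A 1 * M * (lam v)⁻¹) →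
      Wpa v * lam v ≤ N₀ * M ^ 2 → 0 < M * Real.sqrt (Zen v) * Real.sqrt (Wpa v) →
      ∀ P : Finset E3, (↑P : Set E3) ⊆ {x | M / 2 ≤ ‖v x‖} → (∀ p ∈ P, ∀ q ∈ P, p ≠ q → lam v ≤ dist p q) → P.card ≤ m₀)
    (hn₀ : 0 < n₀) (hδ : 0 < δ) (hδ2 : δ ≤ 1 / 2) (hτ : 0 < τ) (hτdef : τ = (1 - δ / 2) ^ 2 - (1 - 3 * δ / 4) ^ 2)
    (hCz : Cz = 48 * 36 * 256 ^ 3 * (2 * max 1 (S ^ 2 / τ)) ^ 3)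
    (hVtot : Vtot = m₀ * (2 * 7 ^ m₀) ^ 3 * ((volume : Measure E3) (ball (0 : E3) 1)).toReal)
    (hΛge1 : ‖curlCLM‖ * (8 * Cz * (‖crossCLM‖ * S * (2 * 7 ^ m₀ + 3))) ≤ Λ)
    (hΛge2 : 3 * ‖curlCLM‖ ^ 4 * (8 * Cz * (‖crossCLM‖ * S * (2 * 7 ^ m₀ + 3))) ^ 2 * Vtot / n₀ ≤ Λ ^ 2)
    (hadm : IsAdm v M B) (hreg : IsReg A v M) (hsp : Wpa v * lam v ≤ N₀ * M ^ 2) (hlow : n₀ * M ^ 2 ≤ Wpa v * lam v)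
    (hpos : 0 < M * Real.sqrt (Zen v) * Real.sqrt (Wpa v)) :
    ∃ η : E3 → E3, ContDiff ℝ ∞ η ∧ HasCompactSupport η ∧
      (∀ x, η x ≠ 0 → (1 - 3 * δ / 4) * M ≤ ‖v x‖) ∧ (∀ x, ‖η x‖ ≤ (‖crossCLM‖ * S * (2 * 7 ^ m₀ + 3) + 1) * M * lam v) ∧
      (∀ σ : ℝ, |σ| ≤ δ / (2 * (2 + ‖curlCLM‖ * Cz * (‖crossCLM‖ * S * (2 * 7 ^ m₀ + 3) + 1))) →
        ∀ x, ‖v x + σ • curl η x‖ ≤ (1 - σ) * M) ∧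
      (∀ x, ‖fderiv ℝ (curl η) x‖ ≤ Λ * M * (lam v)⁻¹) ∧
      Zen (curl η) ≤ Λ ^ 2 * Zen v ∧ Wpa (curl η) ≤ Λ ^ 2 * Wpa v := by
  obtain ⟨hv, hdiv, hM, hB, h0, h1, h2⟩ := hadm
  have hc0 : 0 ≤ ‖crossCLM‖ := norm_nonneg crossCLM
  have hΨ₀0 : 0 ≤ ‖crossCLM‖ * S * (2 * 7 ^ m₀ + 3) := by positivity
  -- non-degeneracy and the two scales `λ`, `L = λ⁻¹`
  have hZ0 : 0 ≤ Zen v := integral_nonneg fun x => by positivity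
  have hW0 : 0 ≤ Wpa v := integral_nonneg fun x => frobeniusNormSq_nonneg _
  have hMpos : 0 < M := by
    by_contra h
    exact absurd hpos (not_lt.2 (mul_nonpos_of_nonpos_of_nonneg
      (mul_nonpos_of_nonpos_of_nonneg (not_lt.1 h) (Real.sqrt_nonneg _)) (Real.sqrt_nonneg _)))
  have hsZpos : 0 < Real.sqrt (Zen v) :=
    lt_of_le_of_ne (Real.sqrt_nonneg _) fun h => by rw [← h] at hpos; simp at hpos
  have hsWpos : 0 < Real.sqrt (Wpa v) :=
    lt_of_le_of_ne (Real.sqrt_nonneg _) fun h => by rw [← h] at hpos; simp at hpos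
  have hZpos : 0 < Zen v := Real.sqrt_pos.1 hsZpos
  have hWpos : 0 < Wpa v := Real.sqrt_pos.1 hsWpos
  have hlampos : 0 < lam v := Real.sqrt_pos.2 (div_pos hZpos hWpos)
  have hZeq : Zen v = lam v ^ 2 * Wpa v := by
    have h := Real.sq_sqrt (div_nonneg hZ0 hW0)
    rw [show Real.sqrt (Zen v / Wpa v) = lam v from rfl] at h
    rw [h, div_mul_cancel₀ _ hWpos.ne']
  set L : ℝ := (lam v)⁻¹ with hLdef
  have hL0 : 0 ≤ L := by rw [hLdef]; positivity
  have hlamL : lam v * L = 1 := by rw [hLdef]; exact mul_inv_cancel₀ hlampos.ne'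
  -- the uniform derivative budget, the count, the patched potential
  have hK : ∀ i, i ≤ 3 → ∀ z, ‖iteratedFDeriv ℝ i v z‖ ≤ S * M * L ^ i := by
    intro i hi z
    refine (hreg i z).trans ?_
    exact mul_le_mul_of_nonneg_right (mul_le_mul_of_nonneg_right (hAS i hi) hMpos.le) (pow_nonneg hL0 i)
  have hD1 : ∀ x, ‖iteratedFDeriv ℝ 1 v x‖ ≤ A 1 * M * (lam v)⁻¹ := fun x => by simpa using hreg 1 x
  have hbound := hm₀ v M B ⟨hv, hdiv, hM, hB, h0, h1, h2⟩ hD1 hsp hpos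
  obtain ⟨ψ, K, hψ, hKc, hKvol, hTK, hψT⟩ :=
    exists_patchedPotential hv hdiv hS0 hMpos.le hL0 hlampos hlamL hK m₀ hbound
  have hKvol' : (volume K).toReal ≤ Vtot * lam v ^ 3 := hKvol.trans (le_of_eq (by rw [hVtot]; ring))
  have hψT' : ∀ x, M / 2 ≤ ‖v x‖ → curl ψ x = v x ∧
      ∀ i, i ≤ 3 → ‖iteratedFDeriv ℝ i ψ x‖ ≤ (‖crossCLM‖ * S * (2 * 7 ^ m₀ + 3)) * (M * lam v) * L ^ i := by
    intro x hx
    refine ⟨(hψT x hx).1, fun i hi => ((hψT x hx).2 i hi).trans (mul_le_mul_of_nonneg_right ?_ (pow_nonneg hL0 i))⟩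
    have hi3 : (i : ℝ) ≤ 3 := by exact_mod_cast hi
    have hb : 0 ≤ ‖crossCLM‖ * S * M * lam v := by positivity
    have := mul_le_mul_of_nonneg_left (by linarith : (2 : ℝ) * 7 ^ m₀ + i ≤ 2 * 7 ^ m₀ + 3) hb
    linarith
  exact exists_eta_of_data (a := (1 - 3 * δ / 4) ^ 2) (Λ := Λ) hv hM hMpos hlampos hL0 hlamL hZeq hn₀ hlow hδ hδ2 hτ
    rfl (by rw [hτdef]; ring) hK hCz hΨ₀0 hψ hKc hKvol' hTK hψT' hΛge1 hΛge2

/-- **THE TOP TEST FIELD** (step P4 of the sparse bang-bang line; see the module docstring). [folklore] -/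
theorem exists_topTestField (A : ℕ → ℝ) (hA : ∀ j, 1 ≤ A j) (N₀ : ℝ) {n₀ : ℝ} (hn₀ : 0 < n₀) :
    ∃ Ψ₀ : ℝ, 0 < Ψ₀ ∧ ∀ δ : ℝ, 0 < δ → δ ≤ 1 / 2 → ∃ Λ σ₀ : ℝ, 1 ≤ Λ ∧ 0 < σ₀ ∧ σ₀ ≤ 1 ∧
      ∀ (v : E3 → E3) (M B : ℝ), IsAdm v M B → IsReg A v M → Wpa v * lam v ≤ N₀ * M ^ 2 →
        n₀ * M ^ 2 ≤ Wpa v * lam v → 0 < M * Real.sqrt (Zen v) * Real.sqrt (Wpa v) →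
        ∃ η : E3 → E3, ContDiff ℝ ∞ η ∧ HasCompactSupport η ∧
          (∀ x, η x ≠ 0 → (1 - 3 * δ / 4) * M ≤ ‖v x‖) ∧ (∀ x, ‖η x‖ ≤ Ψ₀ * M * lam v) ∧
          (∀ σ : ℝ, |σ| ≤ σ₀ → ∀ x, ‖v x + σ • curl η x‖ ≤ (1 - σ) * M) ∧
          (∀ x, ‖fderiv ℝ (curl η) x‖ ≤ Λ * M * (lam v)⁻¹) ∧
          Zen (curl η) ≤ Λ ^ 2 * Zen v ∧ Wpa (curl η) ≤ Λ ^ 2 * Wpa v := by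
  -- δ-free constants
  set S : ℝ := A 0 + A 1 + A 2 + A 3 with hSdef
  have hA0 : ∀ j, 0 ≤ A j := fun j => le_trans zero_le_one (hA j)
  have hS0 : 0 ≤ S := by rw [hSdef]; linarith [hA0 0, hA0 1, hA0 2, hA0 3]
  have hAS : ∀ j, j ≤ 3 → A j ≤ S := by
    intro j hj
    interval_cases j <;> (rw [hSdef]; linarith [hA0 0, hA0 1, hA0 2, hA0 3])
  obtain ⟨m₀, hm₀⟩ := card_separated_halfTop_le (A₁ := A 1) (N₀ := N₀) (hA 1)
  have hc0 : 0 ≤ ‖crossCLM‖ := norm_nonneg crossCLM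
  set Ψ₀ : ℝ := ‖crossCLM‖ * S * (2 * 7 ^ m₀ + 3) with hΨ₀def
  have hΨ₀0 : 0 ≤ Ψ₀ := by rw [hΨ₀def]; positivity
  set Vtot : ℝ := m₀ * (2 * 7 ^ m₀) ^ 3 * ((volume : Measure E3) (ball (0 : E3) 1)).toReal with hVtotdef
  have hVtot0 : 0 ≤ Vtot := by rw [hVtotdef]; positivity
  refine ⟨Ψ₀ + 1, by linarith, ?_⟩
  intro δ hδ hδ2
  -- δ-dependent constants
  set τ : ℝ := (1 - δ / 2) ^ 2 - (1 - 3 * δ / 4) ^ 2 with hτdef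
  have hτ : 0 < τ := by
    have : τ = δ / 4 * (2 - 5 * δ / 4) := by rw [hτdef]; ring
    rw [this]; exact mul_pos (by linarith) (by linarith)
  set Cz : ℝ := 48 * 36 * 256 ^ 3 * (2 * max 1 (S ^ 2 / τ)) ^ 3 with hCzdef
  have hmax0 : 0 ≤ 2 * max 1 (S ^ 2 / τ) := by linarith [le_max_left (1 : ℝ) (S ^ 2 / τ)]
  have hCz0 : 0 ≤ Cz := by rw [hCzdef]; positivity
  set Cη : ℝ := 8 * Cz * Ψ₀ with hCηdef
  have hCη0 : 0 ≤ Cη := by rw [hCηdef]; positivity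
  set Λ' : ℝ := ‖curlCLM‖ * Cz * (Ψ₀ + 1) with hΛ'def
  have hΛ'0 : 0 ≤ Λ' := by rw [hΛ'def]; positivity
  set Λ : ℝ := 1 + ‖curlCLM‖ * Cη + 3 * ‖curlCLM‖ ^ 4 * Cη ^ 2 * Vtot / n₀ with hΛdef
  have ht1 : 0 ≤ ‖curlCLM‖ * Cη := by positivity
  have ht2 : 0 ≤ 3 * ‖curlCLM‖ ^ 4 * Cη ^ 2 * Vtot / n₀ := by positivity
  have hΛ1 : 1 ≤ Λ := by rw [hΛdef]; linarith
  have hΛge1 : ‖curlCLM‖ * Cη ≤ Λ := by rw [hΛdef]; linarith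
  have hΛge2 : 3 * ‖curlCLM‖ ^ 4 * Cη ^ 2 * Vtot / n₀ ≤ Λ ^ 2 :=
    (show 3 * ‖curlCLM‖ ^ 4 * Cη ^ 2 * Vtot / n₀ ≤ Λ by rw [hΛdef]; linarith).trans (le_self_pow₀ hΛ1 two_ne_zero)
  have hσ₀pos : 0 < δ / (2 * (2 + Λ')) := by positivity
  have hσ₀le : δ / (2 * (2 + Λ')) ≤ δ / 4 := div_le_div_of_nonneg_left hδ.le (by norm_num) (by linarith)
  refine ⟨Λ, δ / (2 * (2 + Λ')), hΛ1, hσ₀pos, by linarith, ?_⟩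
  intro v M B hadm hreg hsp hlow hpos
  exact exists_eta_of_field hAS hS0 hm₀ hn₀ hδ hδ2 hτ hτdef hCzdef hVtotdef
    (by rw [← hΨ₀def, ← hCηdef]; exact hΛge1) (by rw [← hΨ₀def, ← hCηdef]; exact hΛge2) hadm hreg hsp hlow hpos

end DepletionLadder.KStar.BangBang

end Summit.NavierStokesRegularity.NavierStokesRegularity.Theorems

end
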